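import Literature.Analysis.FluidPDE.KNSSLiouville
import Literature.Analysis.FluidPDE.LerayHopf
import Literature.Analysis.FluidPDE.VectorCalculus
import Literature.Analysis.FunctionSpaces.BMO
import Literature.Analysis.FunctionSpaces.BMOInvProofs
import HarnessLib

/-!
# Lei–Zhang 2011: Liouville theorem and `L^∞_t BMO_x` stream-function regularity for the
# axially symmetric Navier–Stokes equations

Trunk `Literature/Analysis/FluidPDE`, family NS; cite/fact item `wi-08120` (route
`NavierStokesRegularity/SwirlSignGeometry`, support `PoloidalCirculationCriterion` and crux
`SignChangeAtSingularAxisPoints`). Two theorems of Z. Lei, Q. S. Zhang, *A Liouville theorem for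
the axially-symmetric Navier–Stokes equations*, J. Funct. Anal. 261 (2011) 2323–2345 =
arXiv:1011.5066 (`LeiZhang2011`; read: arXiv pp. 3–4 (§1, statements) and p. 12 (§4, proofs)),
vendored as named facts in the classes the tree already uses for Koch–Nadirashvili–Seregin–Šverák
(`KNSSLiouville.lean`: bounded weak ancient solutions `IsBoundedWeakNSSolutionOn`, axisymmetry
through `rotZ`, the swirl `swirl u = r u_θ`) and for the Cauchy problem (`SuitableWeak.lean`,
`LerayHopf.lean`), with the tree's `BMO` seminorm of a vector field (`eBMOSeminormVec`,
`FunctionSpaces/BMO.lean`) and classical `curl` (`VectorCalculus.lean`).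

**Theorem 1.2** (arXiv p. 4). "Let `v = v(x, t)` be a bounded, weak ancient solution to
(axi-NS). Suppose also `r |v^θ|` is bounded and the stream function is a BMO function. Then
`v ≡ 0`." ("a function `B` is called a stream function of `v` if `v = ∇ × B`", p. 4; proof, p. 12:
Theorem 1.1 forces `v^θ ≡ 0`, KNSS Theorem 5.2 gives `v = (0, 0, l(t))`, and a harmonic BMO
stream function is bounded, hence constant.)

**Theorem 1.4** (arXiv p. 4). "Let `v = v(x, t)` be a suitable weak solution to (axi-NS) in the
space time region `ℝ³ × [0, T]`. Assume that the initial value satisfies `v(·, 0) ∈ L²`,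
`|r v^θ(x, 0)| < C`. Suppose also `v(·, t) = ∇ × B(·, t)` with `sup_{0<t<T} ‖B(·, t)‖_BMO ≤ C_*`.
Then `v` is smooth in `ℝ³ × (0, T]`. Here `C` and `C_*` are arbitrary positive constants."

## Tree form (what is weaker than printed, and why)

* Theorem 1.2 → `LeiZhang2011_liouville`: verbatim the shape of the tree's KNSS Theorem 5.3
  (`KNSS2009_liouville_bound_C_over_r`): `u` a bounded weak solution on `(−∞, 0) × ℝ³` in the
  KNSS class with viscosity `1`, a.e.-axisymmetric slices, `|swirl (u t)| = |r u_θ| ≤ C` a.e., and a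
  stream function `B` whose slices are DIFFERENTIABLE with `curl (B t) = u t` a.e. and
  `‖B t‖_BMO ≤ C_* < ∞` for a.e. `t < 0`; conclusion `u t = 0` a.e. for a.e. `t`. Requiring
  differentiable stream slices (so that the classical `curl` applies and `B t` is locally
  integrable, guarding the junk value of `eBMOSeminorm`) is stronger than the printed hypothesis,
  so the fact is weaker than the theorem.
* Theorem 1.4 → `LeiZhang2011_regularity_bmoStream`: `(v, p)` a suitable weak solution
  (`IsSuitableWeakSolutionOn`, CKN class) of Navier–Stokes with `ν = 1`, `f = 0` on the open slab
  `(0, T) × ℝ³` which is ALSO a Leray–Hopf solution of the Cauchy problem on `[0, T)` with datum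
  `v 0` (`IsLerayHopfOn`; this pins "the initial value" `v(·, 0) ∈ L²`), with axisymmetric slices,
  `|swirl (v 0)| ≤ C` everywhere, and differentiable stream slices `curl (B t) = v t` with
  `‖B t‖_BMO ≤ C_* < ∞` for all `t ∈ (0, T)`; conclusion: `v` agrees a.e. on `(0, T) × ℝ³` with a
  field `w` that is smooth (`C^∞`) on `(0, T] × ℝ³`. Extra hypotheses only; the conclusion is the
  printed "`v` is smooth in `ℝ³ × (0, T]`" for the a.e.-defined field.
* Not vendored here: Theorem 1.1 (Hölder continuity of `Γ = r v^θ` at the axis under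
  `‖b‖_E = HSE(b₁) + sup_t ‖B‖_BMO + sup r|b₃| < ∞`), which needs the class `E` (hollowed scaled
  energy, the decomposition `b = b₁ + b₂ + b₃`) and local `L^∞_loc` weak solutions of (axi-NS) on
  parabolic cylinders — vocabulary the tree does not have yet.
-/

noncomputable section

open MeasureTheory Set Function Filter Topology TopologicalSpace
open scoped InnerProductSpace RealInnerProductSpace NNReal ENNReal ContDiff

namespace Literature.Analysis.FluidPDE

open Literature.Analysis.FunctionSpaces

local notation "ℝ³" => EuclideanSpace ℝ (Fin 3)

/-- **A stream function with slices in `BMO`** for the field `u` on the time set `S`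
(Lei–Zhang: "a function `B` is called a stream function of `v` if `v = ∇ × B`", with
`sup_t ‖B(·, t)‖_BMO ≤ C_*`): for every `t ∈ S` the slice `B t` is differentiable,
`curl (B t) = u t` almost everywhere, and `‖B t‖_BMO ≤ C` (the tree's `eBMOSeminormVec`), for a
finite constant `C`. Differentiability of the slices is a rendering choice (classical `curl`;
it also makes `B t` locally integrable). [cite: LeiZhang2011, §1 (stream function, before Thm. 1.2; hypothesis of Thms. 1.2 and 1.4)] -/
def HasBMOStreamFunctionOn (S : Set ℝ) (u B : ℝ → ℝ³ → ℝ³) (C : ℝ≥0) : Prop :=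
  ∀ t ∈ S, Differentiable ℝ (B t) ∧ curl (B t) =ᵐ[volume] u t ∧ eBMOSeminormVec (B t) ≤ C

/-- The `BMO` seminorm of the zero vector field vanishes (each component pairing is the zero
scalar function, `eBMOSeminorm_zero`). [folklore] -/
theorem eBMOSeminormVec_zero : eBMOSeminormVec (0 : ℝ³ → ℝ³) = 0 := by
  refine le_antisymm (iSup₂_le fun v _ => ?_) bot_le
  have : (fun x : ℝ³ => ⟪(0 : ℝ³ → ℝ³) x, v⟫) = 0 := funext fun x => by simp
  rw [this, eBMOSeminorm_zero]

/-- The zero field has the zero stream function (with `BMO` bound `0`) on any time set;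
non-vacuity of `HasBMOStreamFunctionOn`. [folklore] -/
theorem hasBMOStreamFunctionOn_zero (S : Set ℝ) : HasBMOStreamFunctionOn S 0 0 0 := by
  intro t _
  refine ⟨differentiable_const 0, Eventually.of_forall fun x => ?_, ?_⟩
  · -- `curl 0 = 0`
    simp [curl]
  · simp [eBMOSeminormVec_zero]

/-! ### Theorem 1.2: the Liouville theorem -/

/-- **Lei–Zhang 2011, Theorem 1.2 (Liouville theorem for bounded weak ancient axisymmetric
solutions with bounded `r v^θ` and `BMO` stream function).** Printed: "Let `v = v(x,t)` be a
bounded, weak ancient solution to (axi-NS). Suppose also `r |v^θ|` is bounded and the stream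
function is a BMO function. Then `v ≡ 0`." Tree form, in the KNSS class of
`KNSS2009_liouville_bound_C_over_r` (whose hypothesis `r‖v‖ ≤ C` it relaxes): `u` a bounded weak
solution of Navier–Stokes (viscosity `1`) on `(−∞, 0) × ℝ³`, slices axisymmetric a.e.,
`|swirl (u t) x| = |r u_θ| ≤ C` for a.e. `(t, x)`, and a stream function with differentiable
slices, `curl (B t) = u t` a.e. and `‖B t‖_BMO ≤ C_*` for a.e. `t < 0`; then `u t = 0` a.e. for
a.e. `t < 0`. Extra regularity asked of `B` only (weaker than printed). This "gives a proof of
[the KNSS Liouville] conjecture" under these two conditions (Remark 1.3). Not in Mathlib; stated as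
a `Prop`. [cite: LeiZhang2011, Thm. 1.2 (arXiv:1011.5066 p. 4; proof §4 p. 12)] -/
def LeiZhang2011_liouville : Prop :=
  ∀ ⦃u : ℝ → ℝ³ → ℝ³⦄, IsBoundedWeakNSSolutionOn (Iio 0) isOpen_Iio 1 u →
    (∀ θ : ℝ, ∀ᵐ t ∂(volume.restrict (Iio (0 : ℝ))),
      (fun x => u t (rotZ θ x)) =ᵐ[volume] fun x => rotZ θ (u t x)) →
    (∃ C : ℝ, ∀ᵐ t ∂(volume.restrict (Iio (0 : ℝ))), ∀ᵐ x ∂(volume : Measure ℝ³),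
      |swirl (u t) x| ≤ C) →
    (∃ (B : ℝ → ℝ³ → ℝ³) (C : ℝ≥0), ∀ᵐ t ∂(volume.restrict (Iio (0 : ℝ))),
      Differentiable ℝ (B t) ∧ curl (B t) =ᵐ[volume] u t ∧ eBMOSeminormVec (B t) ≤ C) →
      ∀ᵐ t ∂(volume.restrict (Iio (0 : ℝ))), u t =ᵐ[volume] 0

/-! ### Theorem 1.4: regularity under an `L^∞_t BMO_x` stream function -/

/-- **Lei–Zhang 2011, Theorem 1.4 (axisymmetric solutions with `L^∞(0,T; BMO)` stream function
are smooth).** Printed: "Let `v = v(x, t)` be a suitable weak solution to (axi-NS) in the space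
time region `ℝ³ × [0, T]`. Assume that the initial value satisfies `v(·, 0) ∈ L²`,
`|r v^θ(x, 0)| < C`. Suppose also `v(·, t) = ∇ × B(·, t)` with `sup_{0<t<T} ‖B(·, t)‖_BMO ≤ C_*`.
Then `v` is smooth in `ℝ³ × (0, T]`." Tree form: `(v, p)` a suitable weak solution of
Navier–Stokes (`ν = 1`, `f = 0`) on the open slab `(0, T) × ℝ³` (`IsSuitableWeakSolutionOn`,
CKN class) that is also a Leray–Hopf solution on `[0, T)` with datum `v 0 ∈ L²` (`IsLerayHopfOn`),
with axisymmetric slices on `(0, T)`, `|swirl (v 0) x| ≤ C` for all `x`, and a stream function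
with differentiable slices, `curl (B t) = v t` a.e., `‖B t‖_BMO ≤ C_*` for every `t ∈ (0, T)`
(`HasBMOStreamFunctionOn`); conclusion: `v` coincides a.e. on `(0, T) × ℝ³` with a field smooth on
`(0, T] × ℝ³`. Extra hypotheses only (weaker than printed). This "answers [Koch–Tataru's]
question [of regularity in `L^∞([0,T], BMO⁻¹)`] in the axially-symmetric case" (p. 4). Not in
Mathlib; stated as a `Prop`. [cite: LeiZhang2011, Thm. 1.4 (arXiv:1011.5066 p. 4; proof §4 pp. 12–13)] -/
def LeiZhang2011_regularity_bmoStream : Prop :=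
  ∀ (T : ℝ), 0 < T → ∀ (v : ℝ → ℝ³ → ℝ³) (p : ℝ → ℝ³ → ℝ),
    IsSuitableWeakSolutionOn (slab ℝ³ (Ioo 0 T) isOpen_Ioo) 1 0 v p →
    IsLerayHopfOn T 1 0 (v 0) v →
    (∀ t ∈ Ioo 0 T, IsAxisymmetric (v t)) →
    (∃ C : ℝ, ∀ x, |swirl (v 0) x| ≤ C) →
    (∃ (B : ℝ → ℝ³ → ℝ³) (C : ℝ≥0), HasBMOStreamFunctionOn (Ioo 0 T) v B C) →
      ∃ w : ℝ → ℝ³ → ℝ³, ContDiffOn ℝ ∞ (uncurry w) (Ioc 0 T ×ˢ univ) ∧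
        uncurry v =ᵐ[volume.restrict (Ioo 0 T ×ˢ univ)] uncurry w

/-! ### API: pointwise hypotheses on a representative -/

/-- Pointwise stream data at every `t < 0` give the a.e.-in-time form used by
`LeiZhang2011_liouville`. [folklore] -/
theorem ae_stream_of_hasBMOStreamFunctionOn {u B : ℝ → ℝ³ → ℝ³} {C : ℝ≥0}
    (h : HasBMOStreamFunctionOn (Iio 0) u B C) :
    ∀ᵐ t ∂(volume.restrict (Iio (0 : ℝ))),
      Differentiable ℝ (B t) ∧ curl (B t) =ᵐ[volume] u t ∧ eBMOSeminormVec (B t) ≤ C := by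
  filter_upwards [ae_restrict_mem measurableSet_Iio] with t ht
  exact h t ht

/-- A pointwise swirl bound `|Γ(t, x)| ≤ C` at every `t < 0` implies its a.e. form. [folklore] -/
theorem ae_abs_swirl_le_of_forall {u : ℝ → ℝ³ → ℝ³} {C : ℝ}
    (hC : ∀ t < 0, ∀ x, |swirl (u t) x| ≤ C) :
    ∀ᵐ t ∂(volume.restrict (Iio (0 : ℝ))), ∀ᵐ x ∂(volume : Measure ℝ³), |swirl (u t) x| ≤ C := by
  filter_upwards [ae_restrict_mem measurableSet_Iio] with t ht
  exact Eventually.of_forall (hC t ht)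

/-- **Theorem 1.2 for a representative satisfying the hypotheses at every `t < 0`** (the shape of
`SelfSimilarLiouville` / `KNSSLiouville …of_pointwise`): a bounded weak ancient solution with
axisymmetric slices, `|swirl| ≤ C` and a `BMO` stream function at every `t < 0` vanishes a.e.
[cite: LeiZhang2011, Thm. 1.2] -/
theorem LeiZhang2011_liouville.of_pointwise (h : LeiZhang2011_liouville) {u : ℝ → ℝ³ → ℝ³}
    (hu : IsBoundedWeakNSSolutionOn (Iio 0) isOpen_Iio 1 u)
    (haxi : ∀ t < 0, IsAxisymmetric (u t)) {C : ℝ} (hC : ∀ t < 0, ∀ x, |swirl (u t) x| ≤ C)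
    {B : ℝ → ℝ³ → ℝ³} {C' : ℝ≥0} (hB : HasBMOStreamFunctionOn (Iio 0) u B C') :
    ∀ᵐ t ∂(volume.restrict (Iio (0 : ℝ))), u t =ᵐ[volume] 0 :=
  h hu (ae_rotZ_of_isAxisymmetric haxi) ⟨C, ae_abs_swirl_le_of_forall hC⟩
    ⟨B, C', ae_stream_of_hasBMOStreamFunctionOn hB⟩

end Literature.Analysis.FluidPDE
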